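import Literature.MathematicalPhysics.QuantumFieldTheory.MagnenRivasseauSeneor1993.MRS93NestedLattices
import Literature.MathematicalPhysics.QuantumFieldTheory.QuarticDomination
import HarnessLib

/-!
# Magnen–Rivasseau–Sénéor, *Construction of YM₄ with an infrared cutoff* (CMP 155, 1993), Sect. VII p.376: the VERTICAL
# PROTECTION CORRIDOR AS PRINTED — the downward ancestor chain («only one box which contains a box in the next lower frequency»,
# one box per frequency down to `i − K|log λ|`), the bounded upward width («M⁴ boxes of the next higher frequency»), the SPLITTING of
# the large-field small factor `e^{−λ^{−ε}}` along the chain («a small factor of similar order (with ε slightly smaller) to all these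
# boxes») with an explicit threshold `λ ≤ λ₀(ε, ε′, K)`, the gain `M^{−K|log λ|} = λ^{K log M}` against the dominated couplings, and the
# domination bookkeeping «λ^{1/2+ε₁} per field» ∕ «one full λ» — PROVED as counting and real arithmetic about the tree's boxes

finite counting on the tree's anisotropic lattices and elementary real analysis (`log x ≤ x^δ/δ`); nothing here is a claim about the
Yang–Mills mass gap, about continuum YM₄ on `T⁴` (with or without infrared cutoff), or about the Clay problem — and nothing of the
vertical ∕ horizontal ∕ Mayer expansions of Sect. VII (a SKETCH in print), of Lemma II.1 (the SOURCE of the factor `e^{−λ^{−ε}}`), or of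
the functional-integral domination estimates is asserted or formalised: the file proves that the NUMBERS the printed paragraph
manipulates behave as the paragraph says, for the tree's typed boxes

**Citation header (reproduction of PUBLISHED work).** J. Magnen, V. Rivasseau, R. Sénéor, *Construction of YM₄ with an infrared
cutoff*, Commun. Math. Phys. **155** (1993) 325–383 [MagnenRivasseauSeneor1993], Sect. VII «The Convergence of the Expansion: Bounds on Error Terms»,
p.376. Loci «p.NNN [PDF nn] tl.k» = journal page, PDF page (= journal page − 324), text-layer line of the held scan
`paper:magnen1993-cmp155-mrs-ym4-infrared-cutoff`; the quotations below were re-read on the decoded page image of record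
`run/shared/lean/pub/lit-balaban/inprint/lit-balaban-p14/renders-cmp155/p52_full_s6.png` (the text layer garbles the exponents).
Cell pub-balaban-gaps (YM blitz, track G3 «MRS 1993 typed AS PRINTED as the independent second ultraviolet route»), seat mrs-lit-2
(gen 18, file 47); companion record `run/shared/lean/pub/pub-balaban-gaps/g3/MRS-AS-PRINTED-estimates.md`.
**EDITION v1.1 (same seat, gen 20; DOCSTRINGS ONLY — every declaration of v1 byte-identical, no import change):** the p.337 locator
is text-layer tl.2–5 (the running head is line 1), and the p.376 tl.35 quote now reads «the well localized B′ field» as printed (v1 wrote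
«B^{i′}») — the cell referee's R8 nits (GEN 59). Nothing else moves.
Siblings whose vocabulary is USED, not re-typed: `…MRS93PhaseCells` (mrs-lit-1: `PhaseCells.anisoBox M i α k`, the box of `𝐃_{i,α}`
with lower corner `k ∈ ℤ⁴` in units of the sides), `…MRS93NestedLattices` (this seat, file 46: `NestedLattices.ratio`,
`anisoBox_subset_iff`, `fineLabels` ∕ `card_fineLabels_isotropic`, `disjoint_anisoBox`, `existsUnique_coarse_box`),
`…MRS93ConvergencePowerCounting` (file 4: `Convergence.corridor_scale_eq`, `Convergence.largePower_eq` — the two displayed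
identities of the same paragraph, typed there), and `Literature/MathematicalPhysics/QuantumFieldTheory/QuarticDomination.lean`
(file 42: [R] = Rivasseau 1991 §III.2.B (III.2.23)–(III.2.24), the one-cell domination estimate `QuarticDomination.abs_average_mul_exp_le`,
which §5 instantiates at `g = λ⁴`).

**What the paper prints (verbatim, p.376 [PDF 52]).**
* tl.13–20: *«In the small field region the bounds we use are similar to the case of the infrared φ⁴₄ critical theory (see [FMRS1,
  R]); remark however that for the "domination" process, we have to use the small field conditio e^{−E_Δ} in (II.25), which costs a
  factor λ^{1/2+ε₁} per field, rather than the λ⁴A⁴ term (which would cost one full λ). In this way a vertex such as λ²[A, A]² with the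
  worst case of three badly localized legs has still a small factor of order λ^{1/2+ε₁}, because it has at least one well localized
  leg, and if this well localized leg is a small field A′_s, its Gaussian integration does not cost any fraction of λ.»* (sic «conditio»)
* tl.21–31: *«At this point the attentive reader may ask what happens if this well localized leg is of the large field type. More
  generally why do the vertical couplings between high momentum large field regions and lower momentum small field regions also lead
  to small factors? For instance a vertex such as λ[B^i, A^{i′}] with i′ < i, using the λ⁴B⁴ term for domination of the B field seems
  to eat up the factor λ, hence to lead to no small factor. This is not true because the vertical corridor that we decided to include
  can be made much bigger in the direction of lower frequencies than of higher frequencies. Indeed there are M⁴ boxes of the next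
  higher frequency in a typical cubic box, which in practice limit us to consider corridor of bounded width (independent of λ) in the
  vertical direction upwards. But there is only one box which contains a box in the next lower frequency.»*
* tl.31–35: *«If we take into account the fact that we have a small factor of order e^{−λ_i^{−ε}} in a large field box of scale i, we
  can include all the boxes which contain it until frequency i′ = i − K|log λ| in the protection corridor (K being a large constant),
  and still attribute a small factor of similar order (with ε slightly smaller) to all these boxes.»*
* p.337 [PDF 13] tl.2–5 (the same splitting, for the corridors): *«provided we respect to golden rule that their width both in space
  and momentum (index) directions be bounded so that this small factor in the (II.28) divided into the total number p of boxes in the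
  corridors around a single large field box is still small as λ → 0 (i.e. λ^{−ε₁/2} ≫ p). This rule is necessary for the cluster and
  Mayer expansions to converge»* (sic «respect to golden rule»).
* p.376 tl.35–40: *«It is then true that the integration of the well localized B′ field [printed «B′» — v1 of this header wrote «B^{i′}»;
  EDITION v1.1 restores the print] using e.g. the λ⁴B⁴ terms eats up the coupling
  constants, but this is more than compensated by the fact that if we dominate the A^{i′} field using the small field condition we
  gain a small factor M^{−K|log λ|} which comes from writing M^{i′} ≤ M^i M^{−K|log λ|}. This factor is by itself a very large power of λ
  so the corresponding terms are indeed extremely small.»*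

**What is formalised (every statement below is a `theorem` with its proof; `M` a natural number, cast to `ℝ` in `anisoBox`; `λ` is
spelled `lam`).**
* §1 THE DOWNWARD CHAIN (tl.30–33). `coarseLabel M i i′ α α′ k` (the integer quotients `k_μ / r_μ`) with `subset_coarseLabel` and
  **`eq_coarseLabel_of_subset`** ∕ `subset_iff_eq_coarseLabel` («only one box»: a box of `𝐃_{i′,α′}` containing the box `k` of
  `𝐃_{i,α}` IS the box `coarseLabel k`; `i′ ≤ i`, `α′ ≤ α`); **`ancestorChain M i N k`** = the boxes of the isotropic lattices
  `𝐃_{i′,i′}`, `i − N ≤ i′ ≤ i`, containing the box `k` of `𝐃_{i,i}` («all the boxes which contain it until frequency i′ = i − K|log λ|»,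
  `N` standing for `⌊K|log λ|⌋`), `mem_ancestorChain_iff` (membership = containment), **`card_ancestorChain`** (`= N + 1` for `N ≤ i`;
  `card_ancestorChain_eq_min` `= min(N, i) + 1` in general — the frequencies stop at `0`; `card_ancestorChain_le`),
  `existsUnique_mem_ancestorChain_fst` (ONE member per frequency), `self_mem_ancestorChain`.
* §2 THE UPWARD WIDTH (tl.28–30). `sum_card_fineLabels_upward`: the boxes of the `L` next HIGHER isotropic frequencies inside a box of
  `𝐃_{i,i}` number `Σ_{l=1}^{L} M^{4l}` (`≤ L·M^{4L}`, `sum_card_fineLabels_upward_le`) — a function of the width `L` and of `M`, not of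
  `λ`: «corridor of bounded width (independent of λ) in the vertical direction upwards».
* §3 THE SPLITTING (tl.31–35). `one_add_mul_log_le_rpow` (`1 + K log x ≤ x^δ` once `x^{δ/2} ≥ 1 + 2K/δ`, from Mathlib's
  `Real.log_le_rpow_div`), `threshold_of_le`; **`exp_neg_rpow_le_pow`**: for `ε′ < ε`, `K ≥ 0`, `0 < λ < 1` and
  `λ ≤ λ₀ := (1 + 2K/(ε − ε′))^{−2/(ε−ε′)}`, every number `n ≤ 1 + K|log λ|` of boxes satisfies `e^{−λ^{−ε}} ≤ (e^{−λ^{−ε′}})^n` — out of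
  the ONE factor `e^{−λ^{−ε}}` of the large field box each box of the chain receives a factor `e^{−λ^{−ε′}}` «of similar order (with ε
  slightly smaller)»; `exp_neg_rpow_le_pow_of_le_rpow` (the «golden rule» of p.337 tl.2–5 in the same currency: `p ≤ λ^{−(ε−ε′)}`
  boxes each receive `e^{−λ^{−ε′}}`); **`exp_neg_rpow_le_prod_ancestorChain`** ∕ `…_floor` (the same as a product over §1's chain
  with `N ≤ K|log λ|`, resp. literally `N = ⌊K|log λ|⌋`).
* §4 THE GAIN (tl.35–40), joined to file 4. `rpow_le_rpow_mul_largePower`: `M^{i′} ≤ M^i · λ^{K log M}` for every `i′ ≤ i − K|log λ|`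
  (`M ≥ 1`, `0 < λ < 1`; = `Convergence.corridor_scale_eq` + `Convergence.largePower_eq` + monotonicity); `largePower_le_rpow` («a very
  large power of λ»: `λ^{K log M} ≤ λ^p` once `K ≥ p/log M`, `M > 1`); **`couplings_compensated`** («eats up the coupling constants, but
  this is more than compensated»: `λ^{−m}·λ^{K log M} ≤ λ^p` once `K ≥ (m + p)/log M`).
* §5 THE DOMINATION BOOKKEEPING (tl.13–20). **`quartic_domination_costs_full_lambda`** («the λ⁴A⁴ term (which would cost one full
  λ)»: [R]'s one-cell estimate at coupling `g = λ⁴` gives `(1/|Δ|)|∫_Δ φ|·e^{−λ⁴∫_Δ φ⁴} ≤ λ^{−1}·|Δ|^{−1/4}` on any finite-measure cell of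
  any measure space — the tree's `QuarticDomination.abs_average_mul_exp_le`, nothing re-proved); `smallField_domination_cost` (a
  pointwise small-field bound `|φ| ≤ λ^{−(1/2+ε₁)}·C` passes to the cell average: «costs a factor λ^{1/2+ε₁} per field»);
  `vertex_three_bad_legs` (`λ²·(λ^{−(1/2+ε₁)})³ = λ^{1/2−3ε₁}`), `printed_order_gap`, `vertex_factor_lt_one` — see precision (ac).

**Reading conventions.** (i) Frequencies of the corridor are those of the ISOTROPIC lattices `𝐃_{i′,i′}` («cubic box», tl.29); the
anisotropic refinements nest the same way (§1's `coarseLabel` is stated for every `𝐃_{i,α} → 𝐃_{i′,α′}`, `i′ ≤ i`, `α′ ≤ α`).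
(ii) «until frequency i′ = i − K|log λ|»: the chain is indexed by a natural number `N` (the number of lower frequencies included);
the printed real `K|log λ|` enters only through `N ≤ K|log λ|` (§3) resp. `N = ⌊K|log λ|⌋` (`…_floor`); frequencies below `0` do not
exist (`i − N` truncated at `0`, whence `min(N, i)`). (iii) «a small factor of order e^{−λ_i^{−ε}}» is taken as the number
`exp(−λ^{−ε})` with ONE coupling `λ` standing for `λ_i` (p.334: the tentative couplings of the slices differ by bounded factors in
the window considered; the paragraph itself writes both `λ_i` and `λ`); «of similar order (with ε slightly smaller)» = `exp(−λ^{−ε′})`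
for any fixed `ε′ < ε`, valid for `λ ≤ λ₀(ε, ε′, K)` — the threshold is explicit and elementary, not optimised. (iv) In §5 the
cost per field is bookkeeping of powers of `λ`: a field dominated by the positive quartic term with coupling `λ⁴` is bounded at the
price `λ^{−1}` ([R] (III.2.24) with `g = λ⁴`), a field obeying the small field condition at the price `λ^{−(1/2+ε₁)}` (the bound
(II.25)–(II.26) encodes, up to `M^i` and constants collected in `C`); the smeared fields, `E_Δ` and the measure are NOT constructed here
(cf. `…MRS93LargeFieldRegions`, `…MRS93BoxMatchedDecay`).

**As-printed precision (ac) (recorded, NOT adjudicated; no statement elsewhere depends on it).** With the two printed prices, the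
vertex «λ²[A, A]² with the worst case of three badly localized legs» carries `λ² · (λ^{−(1/2+ε₁)})³ = λ^{1/2−3ε₁}`
(`vertex_three_bad_legs`), whereas the sentence calls the outcome «a small factor of order λ^{1/2+ε₁}»; for `0 < λ < 1`, `ε₁ > 0` the
literal product exceeds `λ^{1/2+ε₁}` by the factor `λ^{−4ε₁}` (`printed_order_gap`). Both are of order `λ^{1/2}` up to `λ^{O(ε₁)}`, `ε₁`
being the small fixed positive number of (II.26), and the literal product is itself `< 1` as soon as `ε₁ < 1/6` (`vertex_factor_lt_one`);
which exponent the authors intend is not decidable from the print and immaterial to the paragraph's conclusion.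

**What is NOT claimed.** That these factors OCCUR in MRS's expansion (the vertical expansion, its links and its convergence are a
sketch in print and stay prose); Lemma II.1 (the source of `e^{−λ^{−ε}}`; typed as a predicate by this seat, `LargeField.LemmaII1Printed`);
the domination of fields INSIDE functional integrals beyond [R]'s one-cell mechanism of file 42; the choice of `K`; anything of
Sects. II–VI or VIII; anything of Bałaban's papers. MRS work at FIXED INFRARED CUTOFF (p.328 «which we never try to lift»): nothing
here bears on infinite volume or a mass gap.
-/

noncomputable section

open Set MeasureTheory

namespace Literature.MathematicalPhysics.QuantumFieldTheory.MagnenRivasseauSeneor1993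

namespace VerticalCorridor

open PhaseCells (anisoBox boxSide boxSide_pos)
open NestedLattices (ratio fineLabels)

variable {M : ℕ}

/-! ## §1 The downward chain: «there is only one box which contains a box in the next lower frequency … we can include all the
boxes which contain it until frequency i′ = i − K|log λ|» (Sect. VII p.376 tl.30–33) -/

/-- `ratio ≥ 1` for `M ≥ 1`. [folklore] -/
private theorem one_le_ratio (hM : 0 < M) (i i' : ℕ) (α α' : ℤ) (μ : Fin 4) : 1 ≤ ratio M i i' α α' μ := by
  unfold NestedLattices.ratio; split_ifs <;> exact Nat.one_le_pow _ _ hM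

/-- The label of THE box of `𝐃_{i′,α′}` containing the box `k` of `𝐃_{i,α}` (`i′ ≤ i`, `α′ ≤ α`): the integer quotients
`k_μ / r_μ`, `r = NestedLattices.ratio`, direction by direction. [cite: MagnenRivasseauSeneor1993, Sect. VII p.376 tl.30–31;
§II.B p.335 tl.16–19] -/
def coarseLabel (M i i' : ℕ) (α α' : ℤ) (k : Fin 4 → ℤ) : Fin 4 → ℤ :=
  fun μ => k μ / (ratio M i i' α α' μ : ℤ)

/-- The box `k` of `𝐃_{i,α}` lies in the box `coarseLabel k` of `𝐃_{i′,α′}`. [cite: MagnenRivasseauSeneor1993, Sect. VII p.376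
tl.30–31] -/
theorem subset_coarseLabel (hM : 0 < M) {i i' : ℕ} (hi : i' ≤ i) {α α' : ℤ} (hα : α' ≤ α) (k : Fin 4 → ℤ) :
    anisoBox (M : ℝ) i α k ⊆ anisoBox (M : ℝ) i' α' (coarseLabel M i i' α α' k) := by
  have hr : ∀ μ, (0 : ℤ) < ratio M i i' α α' μ := fun μ => by exact_mod_cast one_le_ratio hM i i' α α' μ
  rw [NestedLattices.anisoBox_subset_iff hM hi hα]
  exact fun μ => ⟨Int.ediv_mul_le _ (hr μ).ne', Int.lt_ediv_add_one_mul_self _ (hr μ)⟩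

/-- **«only one box»**: a box of `𝐃_{i′,α′}` containing the box `k` of `𝐃_{i,α}` IS the box `coarseLabel k`.
[cite: MagnenRivasseauSeneor1993, Sect. VII p.376 tl.30–31] -/
theorem eq_coarseLabel_of_subset (hM : 0 < M) {i i' : ℕ} (hi : i' ≤ i) {α α' : ℤ} (hα : α' ≤ α) {k k' : Fin 4 → ℤ}
    (h : anisoBox (M : ℝ) i α k ⊆ anisoBox (M : ℝ) i' α' k') : k' = coarseLabel M i i' α α' k := by
  -- the uniqueness clause of `NestedLattices.existsUnique_coarse_box`, re-derived from `disjoint_anisoBox` (half-open cells)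
  by_contra hne
  have hMr : (0 : ℝ) < M := by exact_mod_cast hM
  have hne' : (anisoBox (M : ℝ) i α k).Nonempty := by
    rw [PhaseCells.anisoBox, univ_pi_nonempty_iff]
    exact fun μ => nonempty_Ico.2 (by nlinarith [boxSide_pos hMr i α μ])
  obtain ⟨x, hx⟩ := hne'
  exact Set.disjoint_left.1 (NestedLattices.disjoint_anisoBox hMr i' α' hne) (h hx) (subset_coarseLabel hM hi hα k hx)

/-- Containment in a coarser box ⟺ its label is `coarseLabel`. [cite: MagnenRivasseauSeneor1993, Sect. VII p.376 tl.30–31] -/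
theorem subset_iff_eq_coarseLabel (hM : 0 < M) {i i' : ℕ} (hi : i' ≤ i) {α α' : ℤ} (hα : α' ≤ α) (k k' : Fin 4 → ℤ) :
    anisoBox (M : ℝ) i α k ⊆ anisoBox (M : ℝ) i' α' k' ↔ k' = coarseLabel M i i' α α' k :=
  ⟨eq_coarseLabel_of_subset hM hi hα, fun h => h ▸ subset_coarseLabel hM hi hα k⟩

/-- `coarseLabel` to the same lattice is the identity (the chain starts at the box itself). [cite: MagnenRivasseauSeneor1993, Sect. VII
p.376 tl.30–33] -/
theorem coarseLabel_self (M i : ℕ) (α : ℤ) (k : Fin 4 → ℤ) : coarseLabel M i i α α k = k := by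
  funext μ
  simp [coarseLabel, NestedLattices.ratio]

/-- The ANCESTOR CHAIN of the box `k` of the isotropic lattice `𝐃_{i,i}` down to frequency `i − N`: the pairs (frequency `i′`, label of
the box of `𝐃_{i′,i′}` containing it), `i − N ≤ i′ ≤ i` — «we can include all the boxes which contain it until frequency i′ = i − K|log λ|
in the protection corridor» (p.376 tl.32–33), with `N` standing for the integer part of `K|log λ|`.
[cite: MagnenRivasseauSeneor1993, Sect. VII p.376 tl.30–33] -/
def ancestorChain (M i N : ℕ) (k : Fin 4 → ℤ) : Finset (ℕ × (Fin 4 → ℤ)) :=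
  (Finset.Icc (i - N) i).image fun i' => (i', coarseLabel M i i' i i' k)

/-- Membership in the ancestor chain = being a box of an isotropic lattice of frequency `i′ ∈ [i − N, i]` that CONTAINS the given box.
[cite: MagnenRivasseauSeneor1993, Sect. VII p.376 tl.30–33] -/
theorem mem_ancestorChain_iff (hM : 0 < M) (i N : ℕ) (k : Fin 4 → ℤ) (p : ℕ × (Fin 4 → ℤ)) :
    p ∈ ancestorChain M i N k ↔
      i - N ≤ p.1 ∧ p.1 ≤ i ∧ anisoBox (M : ℝ) i i k ⊆ anisoBox (M : ℝ) p.1 p.1 p.2 := by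
  constructor
  · intro h
    obtain ⟨i', hi', rfl⟩ := Finset.mem_image.1 h
    rw [Finset.mem_Icc] at hi'
    exact ⟨hi'.1, hi'.2, subset_coarseLabel hM hi'.2 (by exact_mod_cast hi'.2) k⟩
  · rintro ⟨h1, h2, h3⟩
    obtain ⟨j, k'⟩ := p
    rw [ancestorChain, Finset.mem_image]
    exact ⟨j, Finset.mem_Icc.2 ⟨h1, h2⟩, Prod.ext rfl (eq_coarseLabel_of_subset hM h2 (by exact_mod_cast h2) h3).symm⟩

/-- **The chain has exactly `min(N, i) + 1` boxes, ONE per frequency** (the frequencies stop at `0`): «only one box which contains a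
box in the next lower frequency» iterated. [cite: MagnenRivasseauSeneor1993, Sect. VII p.376 tl.30–33] -/
theorem card_ancestorChain_eq_min (M i N : ℕ) (k : Fin 4 → ℤ) : (ancestorChain M i N k).card = min N i + 1 := by
  rw [ancestorChain, Finset.card_image_of_injective _ fun a b h => (Prod.ext_iff.1 h).1, Nat.card_Icc]
  omega

/-- For `N ≤ i` the chain has exactly `N + 1` boxes. [cite: MagnenRivasseauSeneor1993, Sect. VII p.376 tl.30–33] -/
theorem card_ancestorChain (M : ℕ) {i N : ℕ} (hN : N ≤ i) (k : Fin 4 → ℤ) : (ancestorChain M i N k).card = N + 1 := by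
  rw [card_ancestorChain_eq_min, min_eq_left hN]

/-- In every case the chain has at most `N + 1` boxes. [cite: MagnenRivasseauSeneor1993, Sect. VII p.376 tl.30–33] -/
theorem card_ancestorChain_le (M i N : ℕ) (k : Fin 4 → ℤ) : (ancestorChain M i N k).card ≤ N + 1 := by
  rw [card_ancestorChain_eq_min]; omega

/-- The given box itself heads its chain (frequency `i`, its own label). [cite: MagnenRivasseauSeneor1993, Sect. VII p.376 tl.30–33] -/
theorem self_mem_ancestorChain (M i N : ℕ) (k : Fin 4 → ℤ) : (i, k) ∈ ancestorChain M i N k := by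
  refine Finset.mem_image.2 ⟨i, Finset.mem_Icc.2 ⟨Nat.sub_le i N, le_rfl⟩, ?_⟩
  rw [coarseLabel_self]

/-- For every frequency `i′ ∈ [i − N, i]` exactly one member of the chain has that frequency. [cite: MagnenRivasseauSeneor1993,
Sect. VII p.376 tl.30–31] -/
theorem existsUnique_mem_ancestorChain_fst (hM : 0 < M) {i N i' : ℕ} (h1 : i - N ≤ i') (h2 : i' ≤ i) (k : Fin 4 → ℤ) :
    ∃! p : ℕ × (Fin 4 → ℤ), p ∈ ancestorChain M i N k ∧ p.1 = i' := by
  refine ⟨(i', coarseLabel M i i' i i' k), ⟨?_, rfl⟩, ?_⟩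
  · exact Finset.mem_image.2 ⟨i', Finset.mem_Icc.2 ⟨h1, h2⟩, rfl⟩
  · rintro ⟨j, k'⟩ ⟨hmem, rfl⟩
    obtain ⟨-, hj2, hsub⟩ := (mem_ancestorChain_iff hM i N k _).1 hmem
    exact Prod.ext rfl (eq_coarseLabel_of_subset hM hj2 (by exact_mod_cast hj2) hsub)

/-! ## §2 The upward corridor of bounded width: «there are M⁴ boxes of the next higher frequency in a typical cubic box, which in
practice limit us to consider corridor of bounded width (independent of λ) in the vertical direction upwards» (p.376 tl.28–30) -/

/-- The boxes of the `L` next HIGHER isotropic frequencies inside a box of `𝐃_{i,i}` number `Σ_{l=1}^{L} M^{4l}` — a count depending on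
the width `L` and on `M` only, not on `λ`. [cite: MagnenRivasseauSeneor1993, Sect. VII p.376 tl.28–30] -/
theorem sum_card_fineLabels_upward (M i L : ℕ) (k' : Fin 4 → ℤ) :
    ∑ l ∈ Finset.Icc 1 L, (fineLabels M (i + l) i (i + l) i k').card = ∑ l ∈ Finset.Icc 1 L, M ^ (4 * l) := by
  refine Finset.sum_congr rfl fun l _ => ?_
  have h := NestedLattices.card_fineLabels_isotropic M (Nat.le_add_right i l) k'
  push_cast at h ⊢
  rw [h, Nat.add_sub_cancel_left]

/-- … hence at most `L · M^{4L}` of them (`M ≥ 1`). [cite: MagnenRivasseauSeneor1993, Sect. VII p.376 tl.28–30] -/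
theorem sum_card_fineLabels_upward_le (hM : 0 < M) (i L : ℕ) (k' : Fin 4 → ℤ) :
    ∑ l ∈ Finset.Icc 1 L, (fineLabels M (i + l) i (i + l) i k').card ≤ L * M ^ (4 * L) := by
  rw [sum_card_fineLabels_upward]
  calc ∑ l ∈ Finset.Icc 1 L, M ^ (4 * l) ≤ ∑ _l ∈ Finset.Icc 1 L, M ^ (4 * L) :=
        Finset.sum_le_sum fun l hl => Nat.pow_le_pow_right hM (by have := (Finset.mem_Icc.1 hl).2; omega)
    _ = L * M ^ (4 * L) := by rw [Finset.sum_const, Nat.card_Icc, smul_eq_mul, Nat.add_sub_cancel]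

/-! ## §3 Splitting the small factor along the chain: «If we take into account the fact that we have a small factor of order
e^{−λ_i^{−ε}} in a large field box of scale i, we can include all the boxes which contain it until frequency i′ = i − K|log λ| in the
protection corridor (K being a large constant), and still attribute a small factor of similar order (with ε slightly smaller) to all
these boxes» (p.376 tl.31–35) -/

/-- The elementary inequality behind «with ε slightly smaller»: for `x ≥ 1`, `δ > 0`, `K ≥ 0` and `x^{δ/2} ≥ 1 + 2K/δ`,
`1 + K log x ≤ x^δ` (from Mathlib's `log x ≤ x^{δ/2}/(δ/2)`) — the arithmetic of «until frequency i′ = i − K|log λ|» against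
«with ε slightly smaller», `x = λ^{−1}`, `δ = ε − ε′`. [cite: MagnenRivasseauSeneor1993, Sect. VII p.376 tl.31–35] -/
theorem one_add_mul_log_le_rpow {x δ K : ℝ} (hx : 1 ≤ x) (hδ : 0 < δ) (hK : 0 ≤ K) (hbig : 1 + 2 * K / δ ≤ x ^ (δ / 2)) :
    1 + K * Real.log x ≤ x ^ δ := by
  have hx0 : 0 ≤ x := by linarith
  have hlog : Real.log x ≤ x ^ (δ / 2) / (δ / 2) := Real.log_le_rpow_div hx0 (by linarith)
  have h1 : (1 : ℝ) ≤ x ^ (δ / 2) := Real.one_le_rpow hx (by linarith)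
  have hsq : x ^ δ = x ^ (δ / 2) * x ^ (δ / 2) := by
    rw [← Real.rpow_add (by linarith)]; ring_nf
  calc 1 + K * Real.log x ≤ x ^ (δ / 2) + K * (x ^ (δ / 2) / (δ / 2)) := by
        gcongr
    _ = (1 + 2 * K / δ) * x ^ (δ / 2) := by field_simp
    _ ≤ x ^ (δ / 2) * x ^ (δ / 2) := by gcongr
    _ = x ^ δ := hsq.symm

/-- The threshold in terms of `λ`: if `0 < λ ≤ (1 + 2K/δ)^{−2/δ}` then `λ^{−δ/2} ≥ 1 + 2K/δ` (how small `λ` must be for the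
splitting below; explicit, not optimised). [cite: MagnenRivasseauSeneor1993, Sect. VII p.376 tl.31–35] -/
theorem threshold_of_le {lam δ K : ℝ} (hlam : 0 < lam) (hδ : 0 < δ) (hK : 0 ≤ K)
    (hle : lam ≤ (1 + 2 * K / δ) ^ (-(2 / δ))) : 1 + 2 * K / δ ≤ lam⁻¹ ^ (δ / 2) := by
  have hc : 0 < 1 + 2 * K / δ := by positivity
  have h1 : ((1 + 2 * K / δ) ^ (-(2 / δ)))⁻¹ ^ (δ / 2) = 1 + 2 * K / δ := by
    rw [Real.rpow_neg hc.le, inv_inv, ← Real.rpow_mul hc.le]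
    have : 2 / δ * (δ / 2) = 1 := by field_simp
    rw [this, Real.rpow_one]
  rw [← h1]
  exact Real.rpow_le_rpow (by positivity) (by
    rw [inv_le_inv₀ (Real.rpow_pos_of_pos hc _) hlam]; exact hle) (by linarith)

/-- **«a small factor of similar order (with ε slightly smaller) to all these boxes»**: for `ε′ < ε`, `K ≥ 0` and
`0 < λ ≤ λ₀ := (1 + 2K/(ε−ε′))^{−2/(ε−ε′)}` (`λ < 1`), every number `n ≤ 1 + K|log λ|` of boxes can each be given the factor
`e^{−λ^{−ε′}}` out of the one factor `e^{−λ^{−ε}}`: `e^{−λ^{−ε}} ≤ (e^{−λ^{−ε′}})^n`. [cite: MagnenRivasseauSeneor1993, Sect. VII p.376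
tl.31–35] -/
theorem exp_neg_rpow_le_pow {lam ε ε' K : ℝ} {n : ℕ} (hlam : 0 < lam) (hlam1 : lam < 1) (hε : ε' < ε)
    (hK : 0 ≤ K) (hle : lam ≤ (1 + 2 * K / (ε - ε')) ^ (-(2 / (ε - ε')))) (hn : (n : ℝ) ≤ 1 + K * |Real.log lam|) :
    Real.exp (-(lam ^ (-ε))) ≤ Real.exp (-(lam ^ (-ε'))) ^ n := by
  have hδ : 0 < ε - ε' := by linarith
  have hx : 1 ≤ lam⁻¹ := (one_le_inv₀ hlam).2 hlam1.le
  have hlogabs : |Real.log lam| = Real.log lam⁻¹ := by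
    rw [Real.log_inv, abs_of_neg (Real.log_neg hlam hlam1)]
  have hkey : 1 + K * |Real.log lam| ≤ lam⁻¹ ^ (ε - ε') := by
    rw [hlogabs]
    exact one_add_mul_log_le_rpow hx hδ hK (threshold_of_le hlam hδ hK hle)
  rw [← Real.exp_nat_mul, Real.exp_le_exp, mul_neg, neg_le_neg_iff]
  have hpos : 0 < lam ^ (-ε') := Real.rpow_pos_of_pos hlam _
  calc (n : ℝ) * lam ^ (-ε') ≤ (lam⁻¹ ^ (ε - ε')) * lam ^ (-ε') := by
        exact mul_le_mul_of_nonneg_right (hn.trans hkey) hpos.le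
    _ = lam ^ (-ε) := by
        rw [Real.inv_rpow hlam.le, ← Real.rpow_neg hlam.le, ← Real.rpow_add hlam]; ring_nf

/-- **The «golden rule» of p.337 tl.2–5** («their width both in space and momentum (index) directions be bounded so that this small
factor in the (II.28) divided into the total number p of boxes in the corridors around a single large field box is still small as
λ → 0 (i.e. λ^{−ε₁/2} ≫ p)»), in the same currency: if the number `p` of boxes satisfies `p ≤ λ^{−(ε−ε′)}` then
`e^{−λ^{−ε}} ≤ (e^{−λ^{−ε′}})^p` — each of the `p` boxes receives `e^{−λ^{−ε′}}` (`0 < λ`, any `ε′ < ε`; no threshold needed in this form).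
[cite: MagnenRivasseauSeneor1993, §II.B p.337 tl.2–5; Sect. VII p.376 tl.31–35] -/
theorem exp_neg_rpow_le_pow_of_le_rpow {lam ε ε' : ℝ} {p : ℕ} (hlam : 0 < lam) (hp : (p : ℝ) ≤ lam ^ (-(ε - ε'))) :
    Real.exp (-(lam ^ (-ε))) ≤ Real.exp (-(lam ^ (-ε'))) ^ p := by
  rw [← Real.exp_nat_mul, Real.exp_le_exp, mul_neg, neg_le_neg_iff]
  have hpos : 0 < lam ^ (-ε') := Real.rpow_pos_of_pos hlam _
  calc (p : ℝ) * lam ^ (-ε') ≤ lam ^ (-(ε - ε')) * lam ^ (-ε') := mul_le_mul_of_nonneg_right hp hpos.le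
    _ = lam ^ (-ε) := by rw [← Real.rpow_add hlam]; ring_nf

/-- The same with the chain of §1 (at most `N + 1` boxes, `N ≤ K|log λ|`): the one small factor of the large field box dominates the
PRODUCT over its ancestor chain of the attributed factors `e^{−λ^{−ε′}}`. [cite: MagnenRivasseauSeneor1993, Sect. VII p.376 tl.31–35] -/
theorem exp_neg_rpow_le_prod_ancestorChain {lam ε ε' K : ℝ} (M i N : ℕ) (k : Fin 4 → ℤ)
    (hlam : 0 < lam) (hlam1 : lam < 1) (hε : ε' < ε) (hK : 0 ≤ K)
    (hle : lam ≤ (1 + 2 * K / (ε - ε')) ^ (-(2 / (ε - ε')))) (hNK : (N : ℝ) ≤ K * |Real.log lam|) :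
    Real.exp (-(lam ^ (-ε))) ≤ ∏ _p ∈ ancestorChain M i N k, Real.exp (-(lam ^ (-ε'))) := by
  rw [Finset.prod_const]
  have hcard := card_ancestorChain_le M i N k
  have hq1 : Real.exp (-(lam ^ (-ε'))) ≤ 1 := by
    rw [Real.exp_le_one_iff, neg_nonpos]; exact (Real.rpow_pos_of_pos hlam _).le
  calc Real.exp (-(lam ^ (-ε))) ≤ Real.exp (-(lam ^ (-ε'))) ^ (N + 1) :=
        exp_neg_rpow_le_pow hlam hlam1 hε hK hle (by push_cast; linarith)
    _ ≤ Real.exp (-(lam ^ (-ε'))) ^ (ancestorChain M i N k).card :=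
        pow_le_pow_of_le_one (Real.exp_pos _).le hq1 hcard

/-- **The printed corridor literally**: `N = ⌊K|log λ|⌋` («until frequency i′ = i − K|log λ|»), no further hypothesis on `N`.
[cite: MagnenRivasseauSeneor1993, Sect. VII p.376 tl.31–35] -/
theorem exp_neg_rpow_le_prod_ancestorChain_floor {lam ε ε' K : ℝ} (M i : ℕ) (k : Fin 4 → ℤ)
    (hlam : 0 < lam) (hlam1 : lam < 1) (hε : ε' < ε) (hK : 0 ≤ K)
    (hle : lam ≤ (1 + 2 * K / (ε - ε')) ^ (-(2 / (ε - ε')))) :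
    Real.exp (-(lam ^ (-ε))) ≤ ∏ _p ∈ ancestorChain M i ⌊K * |Real.log lam|⌋₊ k, Real.exp (-(lam ^ (-ε'))) :=
  exp_neg_rpow_le_prod_ancestorChain M i _ k hlam hlam1 hε hK hle (Nat.floor_le (by positivity))

/-! ## §4 The gain paying for the couplings: «we gain a small factor M^{−K|log λ|} which comes from writing M^{i′} ≤ M^i M^{−K|log λ|}.
This factor is by itself a very large power of λ» (p.376 tl.37–40) — joined to file 4's `Convergence.corridor_scale_eq` ∕ `largePower_eq` -/

/-- For every frequency `i′ ≤ i − K|log λ|` (real exponents, `M ≥ 1`, `0 < λ < 1`): `M^{i′} ≤ M^i · λ^{K log M}`.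
[cite: MagnenRivasseauSeneor1993, Sect. VII p.376 tl.37–39] -/
theorem rpow_le_rpow_mul_largePower {M K lam i i' : ℝ} (hM : 1 ≤ M) (hlam : 0 < lam) (hlam1 : lam < 1)
    (hi' : i' ≤ i - K * |Real.log lam|) : M ^ i' ≤ M ^ i * lam ^ (K * Real.log M) := by
  have hM0 : 0 < M := by linarith
  rw [← Convergence.largePower_eq hM0 hlam hlam1, ← Convergence.corridor_scale_eq hM0]
  exact Real.rpow_le_rpow_of_exponent_le hM hi'

/-- **«a very large power of λ»**: for every target power `p ≥ 0`, once `K ≥ p / log M` (`M > 1`, `0 < λ < 1`), `λ^{K log M} ≤ λ^p`.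
[cite: MagnenRivasseauSeneor1993, Sect. VII p.376 tl.39–40] -/
theorem largePower_le_rpow {M K lam p : ℝ} (hM : 1 < M) (hlam : 0 < lam) (hlam1 : lam < 1) (hK : p / Real.log M ≤ K) :
    lam ^ (K * Real.log M) ≤ lam ^ p := by
  have hlogM : 0 < Real.log M := Real.log_pos hM
  apply Real.rpow_le_rpow_of_exponent_ge hlam hlam1.le
  rwa [div_le_iff₀ hlogM] at hK

/-- **«eats up the coupling constants, but this is more than compensated»** (p.376 tl.35–38): `m` dominated fields costing `λ^{−1}`
each (§5 `quartic_domination_costs_full_lambda`) against the gain `λ^{K log M}`: for every `m` and every target power `p ≥ 0`, once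
`K ≥ (m + p)/log M` (`M > 1`, `0 < λ < 1`), `λ^{−m} · λ^{K log M} ≤ λ^{p}`. [cite: MagnenRivasseauSeneor1993, Sect. VII p.376 tl.35–40] -/
theorem couplings_compensated {M K lam p : ℝ} {m : ℕ} (hM : 1 < M) (hlam : 0 < lam) (hlam1 : lam < 1)
    (hK : ((m : ℝ) + p) / Real.log M ≤ K) : lam⁻¹ ^ m * lam ^ (K * Real.log M) ≤ lam ^ p := by
  have h := largePower_le_rpow (p := m + p) hM hlam hlam1 hK
  have hm : lam⁻¹ ^ m = lam ^ (-(m : ℝ)) := by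
    rw [Real.rpow_neg hlam.le, Real.rpow_natCast, inv_pow]
  rw [hm, ← le_div_iff₀' (Real.rpow_pos_of_pos hlam _), div_eq_mul_inv, ← Real.rpow_neg hlam.le, neg_neg,
    ← Real.rpow_add hlam]
  rwa [add_comm] at h

/-! ## §5 The domination bookkeeping of p.376 tl.13–20 («for the "domination" process, we have to use the small field conditio[n]
e^{−E_Δ} in (II.25), which costs a factor λ^{1/2+ε₁} per field, rather than the λ⁴A⁴ term (which would cost one full λ). In this way a
vertex such as λ²[A, A]² with the worst case of three badly localized legs has still a small factor of order λ^{1/2+ε₁}») -/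

section Domination

variable {X : Type*} [MeasurableSpace X] {μ : Measure X}

/-- **«the λ⁴A⁴ term (which would cost one full λ)»**: dominating ONE averaged field by the positive quartic term with coupling `λ⁴`
costs `(λ⁴)^{−1/4} = λ^{−1}` — [R]'s domination estimate (the tree's `QuarticDomination.abs_average_mul_exp_le`, Rivasseau 1991
(III.2.23)–(III.2.24)) at `g = λ⁴`: `(1/|Δ|)|∫_Δ φ| · e^{−λ⁴∫_Δ φ⁴} ≤ λ^{−1}·|Δ|^{−1/4}` on any finite-measure cell of any measure space.
[cite: MagnenRivasseauSeneor1993, Sect. VII p.376 tl.15–16; Rivasseau1991, §III.2.B (III.2.24)] -/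
theorem quartic_domination_costs_full_lambda {Δ : Set X} (hΔ : μ Δ ≠ ⊤) (hΔ0 : 0 < μ.real Δ) {φ : X → ℝ}
    (hφ : MemLp φ 4 (μ.restrict Δ)) {lam : ℝ} (hlam : 0 < lam) :
    (μ.real Δ)⁻¹ * |∫ x in Δ, φ x ∂μ| * Real.exp (-(lam ^ 4 * ∫ x in Δ, φ x ^ 4 ∂μ)) ≤
      lam⁻¹ * (μ.real Δ) ^ (-(1 / 4 : ℝ)) := by
  have h := QuarticDomination.abs_average_mul_exp_le hΔ hΔ0 hφ (g := lam ^ 4) (by positivity)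
  have hg : (lam ^ 4 : ℝ) ^ (-(1 / 4 : ℝ)) = lam⁻¹ := by
    rw [show (lam ^ 4 : ℝ) = lam ^ (4 : ℝ) by norm_cast, ← Real.rpow_mul hlam.le]
    norm_num
    exact Real.rpow_neg_one lam
  rwa [hg] at h

/-- **«the small field conditio[n] … costs a factor λ^{1/2+ε₁} per field»**: if a field obeys the pointwise small field bound
`|φ| ≤ λ^{−(1/2+ε₁)}·C` on the cell (the reading of the small field condition, `e^{−E_Δ}` chosen in (II.25), with `C` collecting `M^i` and the harmless constants),
its average obeys the same bound — each dominated field uses up `λ^{1/2+ε₁}` of the couplings. [cite: MagnenRivasseauSeneor1993,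
Sect. VII p.376 tl.14–15; §II.B (II.25)–(II.26) p.335] -/
theorem smallField_domination_cost {Δ : Set X} (hΔ : μ Δ ≠ ⊤) (hΔ0 : 0 < μ.real Δ) {φ : X → ℝ} {lam ε₁ C : ℝ}
    (hφ : ∀ x ∈ Δ, |φ x| ≤ lam ^ (-(1 / 2 + ε₁)) * C) :
    (μ.real Δ)⁻¹ * |∫ x in Δ, φ x ∂μ| ≤ lam ^ (-(1 / 2 + ε₁)) * C := by
  have hΔm : μ.restrict Δ Set.univ < ⊤ := by
    rw [Measure.restrict_apply_univ]; exact hΔ.lt_top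
  have h1 : |∫ x in Δ, φ x ∂μ| ≤ (lam ^ (-(1 / 2 + ε₁)) * C) * μ.real Δ := by
    have := norm_setIntegral_le_of_norm_le_const hΔ.lt_top (fun x hx => (Real.norm_eq_abs _).le.trans (hφ x hx))
    rw [Real.norm_eq_abs] at this
    linarith [this]
  rw [inv_mul_le_iff₀ hΔ0]
  linarith

/-- The vertex arithmetic as the two sentences prescribe it: coupling `λ²`, three badly localized legs each dominated by the small field
condition at the cost `λ^{−(1/2+ε₁)}`: `λ² · (λ^{−(1/2+ε₁)})³ = λ^{1/2 − 3ε₁}` (`λ > 0`). PRECISION (ac), recorded not adjudicated: the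
print calls the outcome «a small factor of order λ^{1/2+ε₁}»; the literal product is `λ^{1/2−3ε₁}`, which for `0 < λ < 1`, `ε₁ > 0`
exceeds `λ^{1/2+ε₁}` by the factor `λ^{−4ε₁}` (`printed_order_gap`) — both are of order `λ^{1/2}` up to `λ^{O(ε₁)}`, `ε₁` being a small
fixed positive number ((II.26)), and nothing downstream in this directory uses either exponent.
[cite: MagnenRivasseauSeneor1993, Sect. VII p.376 tl.16–18] -/
theorem vertex_three_bad_legs (lam ε₁ : ℝ) (hlam : 0 < lam) :
    lam ^ (2 : ℝ) * (lam ^ (-(1 / 2 + ε₁))) ^ 3 = lam ^ (1 / 2 - 3 * ε₁) := by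
  rw [← Real.rpow_natCast, ← Real.rpow_mul hlam.le, ← Real.rpow_add hlam]
  norm_num
  ring_nf

/-- Precision (ac) in numbers: for `0 < λ < 1` and `ε₁ > 0`, `λ^{1/2+ε₁} < λ^{1/2−3ε₁}` (the literal product is LARGER than the printed
order by `λ^{−4ε₁}`). [cite: MagnenRivasseauSeneor1993, Sect. VII p.376 tl.16–18] -/
theorem printed_order_gap {lam ε₁ : ℝ} (hlam : 0 < lam) (hlam1 : lam < 1) (hε₁ : 0 < ε₁) :
    lam ^ (1 / 2 + ε₁) < lam ^ (1 / 2 - 3 * ε₁) :=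
  Real.rpow_lt_rpow_of_exponent_gt hlam hlam1 (by linarith)

/-- … and the literal product is still a genuine small factor: `λ^{1/2−3ε₁} < 1` as soon as `ε₁ < 1/6` (`0 < λ < 1`).
[cite: MagnenRivasseauSeneor1993, Sect. VII p.376 tl.16–18] -/
theorem vertex_factor_lt_one {lam ε₁ : ℝ} (hlam : 0 < lam) (hlam1 : lam < 1) (hε₁ : ε₁ < 1 / 6) :
    lam ^ (1 / 2 - 3 * ε₁) < 1 :=
  Real.rpow_lt_one hlam.le hlam1 (by linarith)

end Domination

end VerticalCorridor

end Literature.MathematicalPhysics.QuantumFieldTheory.MagnenRivasseauSeneor1993
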